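import Summits.AnomalousDissipation.AnomalousDissipation.Theorems.GalerkinSteadyZerothLaw.Negative.StokesStates
import Literature.Analysis.FluidPDE.NSGalerkinStationary
import Literature.Analysis.Calculus.SimplifiedNewton

/-!
# STUB-IDEAS `stub_loudCoatDecades` k = 1 (family RECOGNISE & IMPORT) — helper-lemma signatures (sanity sketch)

Crux stmt-AnomalousDissipation-2986 `MirrorVariety.GalerkinSteadyZerothLaw`, line `idea-sketch-ideator2`
(skeleton `Cruxes/GalerkinSteadyZerothLaw/Lines/idea_sketch_ideator2.lean`, heart `stub_loudCoatDecades`).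
All statements `sorry`; they are the Lean-typed helper lemmas of `STUB-IDEAS-stub_loudCoatDecades-1.md`.
-/

noncomputable section

set_option linter.dupNamespace false

open scoped InnerProductSpace Topology
open MeasureTheory Filter Set Metric
open Literature.Analysis.FunctionSpaces Literature.Analysis.FunctionSpaces.Torus
open Literature.Analysis.FluidPDE Literature.Analysis.FluidPDE.Torus
open Literature.Analysis.Calculus

namespace Summit.AnomalousDissipation.AnomalousDissipation.Cruxes.GalerkinSteadyZerothLaw.StubIdeasLoudCoatDecadesK1

open Summit.AnomalousDissipation.AnomalousDissipation.Theorems.LaminarNeverLoud.Negative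
  (modes energy dissipation modes_symm energy_nonneg)
-- landed chart used by H6: `Summit.AnomalousDissipation.AnomalousDissipation.Theorems.GalerkinSteadyZerothLaw.coat_chart_onto`
-- (`Theorems/MirrorVarietyGalerkinSteadyZerothLawStubCoatChartOnto.lean`, p90004; not imported here: farm snapshot unbuilt)

/-- Coefficient vectors at level `N` (as in the skeleton). -/
abbrev Coeff (N : ℕ) : Type := ↥(modes (Fin 3) N) → EuclideanSpace ℂ (Fin 3)

/-- Real `ℓ²` pairing `∑ Re⟪c k, c' k⟫` (the skeleton's `rin`; the stub writes it inline). -/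
def rin {N : ℕ} (c c' : Coeff N) : ℝ := ∑ k, (inner ℂ (c k) (c' k)).re

/-! ## H0 — CoreFacts: an exact-Euler core at level `2K₀` is one at every level `N ≥ K₀` -/

/-- **H0 `eulerCore_restrict`** (S–M).  If `Cfun` is supported in `modes K₀`, real-solenoidal there, and its
restriction at level `2K₀` (where every triad `l + m = k` of the support is resolved) is annihilated by the unforced
inviscid Galerkin field, then its restriction at EVERY level `N ≥ K₀` is an exact Euler core: the convection sum only
sees `l, m ∈ supp Cfun`, so it is level-independent, and for `|k| > 2K₀` it is empty.  One finite identity at level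
`2K₀` (cell core `K₀ = 2`, ABC `K₀ = 1`) then feeds the stub's core clause at all `N`. [folklore] -/
theorem eulerCore_restrict {K₀ N : ℕ} {Cfun : (Fin 3 → ℤ) → EuclideanSpace ℂ (Fin 3)}
    (hsupp : ∀ k ∉ modes (Fin 3) K₀, Cfun k = 0) (hKN : K₀ ≤ N)
    (hreal : (fun k : ↥(modes (Fin 3) K₀) => Cfun k) ∈ galerkinSubspace (modes (Fin 3) K₀))
    (hcore : galerkinRHS (modes (Fin 3) (2 * K₀)) 0 0 (fun k : ↥(modes (Fin 3) (2 * K₀)) => Cfun k) = 0) :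
    (fun k : ↥(modes (Fin 3) N) => Cfun k) ∈ galerkinSubspace (modes (Fin 3) N) ∧
      galerkinRHS (modes (Fin 3) N) 0 0 (fun k : ↥(modes (Fin 3) N) => Cfun k) = 0 := by
  sorry

/-! ## H1 — a continuous branch over the decade IS a connected `K` projecting onto it -/

/-- **H1 `connected_decade_of_branch`** (S): the graph of a map continuous on `Icc a b` is connected and projects onto
`Icc a b` (`isConnected_Icc.image`). [folklore] -/
theorem connected_decade_of_branch {X : Type*} [TopologicalSpace X] {a b : ℝ} (hab : a ≤ b) {h : ℝ → X}
    (hh : ContinuousOn h (Icc a b)) :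
    IsConnected ((fun ν => (ν, h ν)) '' Icc a b) ∧ Icc a b ⊆ Prod.fst '' ((fun ν => (ν, h ν)) '' Icc a b) := by
  sorry

/-! ## H2 — closed graph + local uniqueness ⇒ the selected zero branch is continuous (degree-free continuation) -/

/-- **H2 `continuousOn_branch_of_unique`** (M).  `G` continuous, `v` continuous on the compact interval, `h ν` the
UNIQUE zero of `G (ν, ·)` in `closedBall (v ν) r`: then `h` is continuous on the interval (its graph is the closed set
`{G = 0} ∩ tube`, bounded in a finite-dimensional space; closed graph into a compact set ⇒ continuous, tree
`continuous_of_isClosed_graph`). [folklore] -/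
theorem continuousOn_branch_of_unique {X : Type*} [NormedAddCommGroup X] [NormedSpace ℝ X] [FiniteDimensional ℝ X]
    {G : ℝ × X → X} (hG : Continuous G) {a b r : ℝ} {v h : ℝ → X} (hv : ContinuousOn v (Icc a b))
    (hsol : ∀ ν ∈ Icc a b, G (ν, h ν) = 0 ∧ h ν ∈ closedBall (v ν) r)
    (huniq : ∀ ν ∈ Icc a b, ∀ x ∈ closedBall (v ν) r, G (ν, x) = 0 → x = h ν) :
    ContinuousOn h (Icc a b) := by
  sorry

/-! ## H3 — Newton tube ⇒ exact zero branch, unique in the tube (pointwise Magnus Prop. 6.7, in tree) -/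

/-- **H3 `branch_of_newton_tube`** (S–M): along the interval, the hypotheses of the tree theorem
`existsUnique_zero_of_simplifiedNewton` for `G (ν, ·)` at the approximate zero `v ν` with uniform-shape constants give a
zero `h ν` in `closedBall (v ν) R`, unique there (`choose`). With H2 the branch is continuous; with H1 it is the stub's `K`.
[cite: Magnus2022, Prop. 6.7] -/
theorem branch_of_newton_tube {X : Type*} [NormedAddCommGroup X] [NormedSpace ℝ X] [CompleteSpace X]
    {G : ℝ × X → X} {G' : ℝ → X → X →L[ℝ] X} {A : ℝ → X ≃L[ℝ] X} {v : ℝ → X} {a b M R : ℝ}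
    (hR : 0 ≤ R) (hM : 0 ≤ M)
    (hG : ∀ ν ∈ Icc a b, ∀ x ∈ closedBall (v ν) R, HasFDerivAt (fun y => G (ν, y)) (G' ν x) x)
    (hA : ∀ ν ∈ Icc a b, G' ν (v ν) = (A ν : X →L[ℝ] X))
    (hLip : ∀ ν ∈ Icc a b, ∀ x ∈ closedBall (v ν) R, ‖G' ν x - G' ν (v ν)‖ ≤ M * ‖x - v ν‖)
    (h₁ : ∀ ν ∈ Icc a b, M * R * ‖((A ν).symm : X →L[ℝ] X)‖ < 1)
    (h₂ : ∀ ν ∈ Icc a b, M * R ^ 2 * ‖((A ν).symm : X →L[ℝ] X)‖ + ‖(A ν).symm (G (ν, v ν))‖ ≤ R) :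
    ∃ h : ℝ → X, ∀ ν ∈ Icc a b, G (ν, h ν) = 0 ∧ h ν ∈ closedBall (v ν) R ∧
      ∀ x ∈ closedBall (v ν) R, G (ν, x) = 0 → x = h ν := by
  sorry

/-! ## H4 — coat-map packaging: the stub's coat clause is the zero set of ONE square polynomial map -/

/-- The readout-projected unforced residual `G_C(ν, h) = V(ν, C+h) − (rin C V / energy C) • C`. -/
def coatRes {N : ℕ} (C : Coeff N) (ν : ℝ) (h : Coeff N) : Coeff N :=
  galerkinRHS (modes (Fin 3) N) ν 0 (C + h) -
    (rin C (galerkinRHS (modes (Fin 3) N) ν 0 (C + h)) / energy C) • C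

/-- **H4a `coat_clause_iff`** (S): for `C ≠ 0`, "residual collinear with the core" is `coatRes C ν h = 0`
(`→`: `rin C ((-s) • C) = -s · energy C`; `←`: `s := -rin C V / energy C`). [folklore] -/
theorem coat_clause_iff {N : ℕ} {ν : ℝ} {C h : Coeff N} (hC0 : C ≠ 0) :
    (∃ s : ℝ, galerkinRHS (modes (Fin 3) N) ν 0 (C + h) = (-s) • C) ↔ coatRes C ν h = 0 := by
  sorry

/-- **H4b `coatRes_mem`** (S–M): the coat map preserves the real subspace of real-solenoidal vectors orthogonal to `C`
(`galerkinRHS_mem` + `rin C (coatRes C ν h) = rin C V − rin C V = 0`), so `G_C(ν, ·)` is a SQUARE map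
`W_C → W_C`, `W_C := galerkinSubspace ⊓ {rin C · = 0}` — the space on which H2/H3 run. [folklore] -/
theorem coatRes_mem {N : ℕ} {ν : ℝ} {C h : Coeff N} (hC : C ∈ galerkinSubspace (modes (Fin 3) N)) (hC0 : C ≠ 0)
    (hh : h ∈ galerkinSubspace (modes (Fin 3) N)) (horth : rin C h = 0) :
    coatRes C ν h ∈ galerkinSubspace (modes (Fin 3) N) ∧ rin C (coatRes C ν h) = 0 := by
  sorry

/-! ## H6 — force-coordinate dressing: a connected branch of loud bounded STEADY STATES of the fixed force `C`
   is a connected coat family over a clamp-viscosity interval (the landed chart `coat_chart_onto`, run on a set) -/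

/-- **H6 `coats_of_steadyBranch`** (M).  A connected set `K'` of Galerkin steady states `c` of the FIXED force vector
`C` at viscosities `ν'` (`galerkinRHS S ν' C c = 0`), with `energy c ≤ E'`, `dissipation ν' c ∈ [ε', M']`, `0 < ε'`,
whose viscosities reach `a` and `b`, is mapped by the landed chart `Φ(ν', c) = (E_C ν'/D, (E_C/D) • c − C)`
(`coat_chart_onto`, `energy_smul`, `dissipation_smul`; `Φ` continuous on `{D > 0}`; `IsPreconnected.image`,
`IsPreconnected.intermediate_value₂` on `fst ∘ Φ`) onto a connected coat family of the stub's shape with windows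
`energy ≤ (E_C/ε')² E'`, `dissipation ∈ [E_C³/M'², E_C³/ε'²]` and clamp viscosities covering `[E_C a/ε', E_C b/M']`.
So the heart may be proved about steady states of ONE fixed force (where `stub_galerkinNewton`, `stub_criticality`,
`FixedViscosityTransfer` and the kit logs live) and never touch clamp coordinates. [folklore] -/
theorem coats_of_steadyBranch {N : ℕ} {C : Coeff N} (hC : C ∈ galerkinSubspace (modes (Fin 3) N)) (hC0 : C ≠ 0)
    {K' : Set (ℝ × Coeff N)} (hK' : IsConnected K') {E' ε' M' a b : ℝ} (hε' : 0 < ε')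
    (hst : ∀ p ∈ K', p.2 ∈ galerkinSubspace (modes (Fin 3) N) ∧ galerkinRHS (modes (Fin 3) N) p.1 C p.2 = 0 ∧
      energy p.2 ≤ E' ∧ ε' ≤ dissipation p.1 p.2 ∧ dissipation p.1 p.2 ≤ M')
    (ha : a ∈ Prod.fst '' K') (hb : b ∈ Prod.fst '' K') :
    ∃ K : Set (ℝ × Coeff N), IsConnected K ∧
      (∀ p ∈ K, (p.2 ∈ galerkinSubspace (modes (Fin 3) N) ∧ (∑ k, (inner ℂ (C k) (p.2 k)).re) = 0 ∧
          ∃ s : ℝ, galerkinRHS (modes (Fin 3) N) p.1 0 (C + p.2) = (-s) • C) ∧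
        energy (C + p.2) ≤ (energy C / ε') ^ 2 * E' ∧ energy C ^ 3 / M' ^ 2 ≤ dissipation p.1 (C + p.2) ∧
          dissipation p.1 (C + p.2) ≤ energy C ^ 3 / ε' ^ 2) ∧
      Icc (energy C * a / ε') (energy C * b / M') ⊆ Prod.fst '' K := by
  sorry

/-! ## ♥ — the residual analytic heart, force-coordinate form (crux-strength; NOT a one-cycle lemma)

`LoudSteadyBranches`: ONE exact-Euler core shape; budgets `E', ε', M'`; a viscosity span `κ > (M'/ε')²`:
for every `j`, frequently in `N`, a CONNECTED set of Galerkin steady states of the fixed force `C` whose viscosities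
cover `[a_j, κ a_j]`, `a_j → 0⁺`, inside the loud-bounded window.  `♥ + H0 + H6 ⇒ stub` (constants in the md);
`♥` in Newton-tube format `+ H3 + H2 + H4 + H1 ⇒ stub` in clamp coordinates. -/
def LoudSteadyBranches : Prop :=
  ∃ (K₀ : ℕ) (Cfun : (Fin 3 → ℤ) → EuclideanSpace ℂ (Fin 3)), (∀ k ∉ modes (Fin 3) K₀, Cfun k = 0) ∧
    ∃ (E' ε' M' κ : ℝ) (alo : ℕ → ℝ), 0 < ε' ∧ ε' ≤ M' ∧ (M' / ε') ^ 2 < κ ∧ (∀ j, 0 < alo j) ∧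
      Tendsto alo atTop (𝓝 0) ∧
      ∀ j, ∃ᶠ N in atTop, ∃ C : Coeff N, (C = fun k : ↥(modes (Fin 3) N) => Cfun k) ∧
        (C ∈ galerkinSubspace (modes (Fin 3) N) ∧ C ≠ 0 ∧ galerkinRHS (modes (Fin 3) N) 0 0 C = 0) ∧
        ∃ K' : Set (ℝ × Coeff N), IsConnected K' ∧
          (∀ p ∈ K', p.2 ∈ galerkinSubspace (modes (Fin 3) N) ∧ galerkinRHS (modes (Fin 3) N) p.1 C p.2 = 0 ∧
            energy p.2 ≤ E' ∧ ε' ≤ dissipation p.1 p.2 ∧ dissipation p.1 p.2 ≤ M') ∧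
          alo j ∈ Prod.fst '' K' ∧ κ * alo j ∈ Prod.fst '' K'

/-- **Assembly check (force form)**: `LoudSteadyBranches → stub_loudCoatDecades` verbatim, via H6 with
`E₁ := (E_C/ε')² E'`, `ε₁ := E_C³/M'²`, `M := E_C³/ε'²`, `ρ := κ ε'/M' > (M'/ε')² = (M/ε₁)^{1/2}`,
`νlo j := E_C alo j / ε'`. [folklore] -/
theorem stub_of_loudSteadyBranches (h : LoudSteadyBranches) :
    ∃ (K₀ : ℕ) (Cfun : (Fin 3 → ℤ) → EuclideanSpace ℂ (Fin 3)), (∀ k ∉ modes (Fin 3) K₀, Cfun k = 0) ∧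
    ∃ (E₁ ε₁ M ρ : ℝ) (νlo : ℕ → ℝ), 0 < ε₁ ∧ 0 < ρ ∧ M < ρ ^ 2 * ε₁ ∧ (∀ j, 0 < νlo j) ∧
      Tendsto νlo atTop (𝓝 0) ∧
      ∀ j, ∃ᶠ N in atTop, ∃ C : ↥(modes (Fin 3) N) → EuclideanSpace ℂ (Fin 3),
        (C = fun k : ↥(modes (Fin 3) N) => Cfun k) ∧
        (C ∈ galerkinSubspace (modes (Fin 3) N) ∧ C ≠ 0 ∧ galerkinRHS (modes (Fin 3) N) 0 0 C = 0) ∧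
        ∃ K : Set (ℝ × (↥(modes (Fin 3) N) → EuclideanSpace ℂ (Fin 3))), IsConnected K ∧
          (∀ p ∈ K, (p.2 ∈ galerkinSubspace (modes (Fin 3) N) ∧ (∑ k, (inner ℂ (C k) (p.2 k)).re) = 0 ∧
              ∃ s : ℝ, galerkinRHS (modes (Fin 3) N) p.1 0 (C + p.2) = (-s) • C) ∧
            energy (C + p.2) ≤ E₁ ∧ ε₁ ≤ dissipation p.1 (C + p.2) ∧ dissipation p.1 (C + p.2) ≤ M) ∧
          Set.Icc (νlo j) (ρ * νlo j) ⊆ Prod.fst '' K := by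
  sorry

end Summit.AnomalousDissipation.AnomalousDissipation.Cruxes.GalerkinSteadyZerothLaw.StubIdeasLoudCoatDecadesK1

end
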